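import Mathlib
import HarnessLib
import Literature.Computability.AlgebraicComplexity.ArithCircuitProofs
import Summits.ValiantsHypothesis.ValiantsHypothesis.Theorems.MonotoneRestorationMonotoneRestorationQPSmlMonotoneColSml

/-!
# Monotone column-set-multilinear families are a CERTIFIED SUB-CASE of `MonotoneRestorationQP`
(route MonotoneRestoration, crux `MonotoneRestorationQP` stmt-ValiantsHypothesis-15886)

`…SmlMonotoneColSml.lean` proved the CONCLUSION of the crux for matrix-symmetric families over `ℝ≥0` given by monotone
column-set-multilinear depth-three circuits `h n = Σ_{t<s} Π_b (β_{t,b} + Σ_a α_{t,b,a} x_{(a,b)})`, `s ≤ n^c + c`.  Here we check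
that these families also satisfy the crux's HYPOTHESIS — total degree `≤ (n+2)^{c'}` and MONOTONE circuit complexity (tree
`complexity` over the semiring `ℝ≥0`) `≤ (n+2)^{c'}` — so that the class is an honest sub-case of the crux, on which it HOLDS:

* `totalDegree_monotoneColSml_le` — the degree is `≤ n`;
* `complexity_monotoneColSml_le` — the monotone complexity is `≤ s (2n² + 2n + 1)` (one gate per arithmetic operation of the
  depth-three formula; `complexity_finset_sum_le`, `complexity_finset_prod_le`);
* `monotoneRestorationQP_hypothesis_of_monotoneColSml` — hence the hypothesis of `MonotoneRestorationQP` with `c' = c + 4`;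
* `monotoneRestorationQP_on_monotoneColSml` — **`MonotoneRestorationQP` HOLDS on the class of matrix-symmetric monotone
  column-set-multilinear `ΣΠΣ` families**: hypothesis and conclusion together.

Honest label: a certified sub-case of an open crux; no registered stub of 15886 is closed; VP ≠ VNP untouched. [folklore]
-/

noncomputable section

open scoped Classical

-- `Summit.ValiantsHypothesis.ValiantsHypothesis.…` is the tree's single-conjunct layout (Sub = Summit).
set_option linter.dupNamespace false

namespace Summit.ValiantsHypothesis.ValiantsHypothesis.Theorems.SmlAffineRestoration

open MvPolynomial Finset Equiv Literature.Computability.AlgebraicComplexity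

/-! ### Degree -/

/-- A monotone affine column form has total degree `≤ 1`. [folklore] -/
theorem totalDegree_nnrealAffineForm_le {n : ℕ} (γ : NNReal) (β : Fin n → NNReal) (b : Fin n) :
    (C γ + ∑ a : Fin n, C (β a) * X (a, b) : MvPolynomial (Fin n × Fin n) NNReal).totalDegree ≤ 1 := by
  refine (totalDegree_add _ _).trans (max_le ?_ ?_)
  · rw [totalDegree_C]; exact Nat.zero_le _
  · refine totalDegree_finsetSum_le fun a _ => (totalDegree_mul _ _).trans ?_
    rw [totalDegree_C, totalDegree_X]

/-- **Degree of a monotone column-sml expression**: `≤ n`. [folklore] -/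
theorem totalDegree_monotoneColSml_le {n s : ℕ} (β : Fin s → Fin n → NNReal) (α : Fin s → Fin n → Fin n → NNReal) :
    (∑ t : Fin s, ∏ b : Fin n, (C (β t b) + ∑ a : Fin n, C (α t b a) * X (a, b)) :
      MvPolynomial (Fin n × Fin n) NNReal).totalDegree ≤ n := by
  refine totalDegree_finsetSum_le fun t _ => (totalDegree_finsetProd _ _).trans ?_
  calc ∑ b : Fin n, (C (β t b) + ∑ a : Fin n, C (α t b a) * X (a, b) : MvPolynomial (Fin n × Fin n) NNReal).totalDegree
      ≤ ∑ _b : Fin n, 1 := Finset.sum_le_sum fun b _ => totalDegree_nnrealAffineForm_le _ _ _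
    _ = n := by simp

/-! ### Monotone complexity -/

/-- A monotone affine column form has monotone complexity `≤ 2n + 1`. [folklore] -/
theorem complexity_nnrealAffineForm_le {n : ℕ} (γ : NNReal) (β : Fin n → NNReal) (b : Fin n) :
    complexity (C γ + ∑ a : Fin n, C (β a) * X (a, b) : MvPolynomial (Fin n × Fin n) NNReal) ≤ 2 * n + 1 := by
  have hterm : ∀ a : Fin n, complexity (C (β a) * X (a, b) : MvPolynomial (Fin n × Fin n) NNReal) ≤ 1 := by
    intro a
    calc complexity (C (β a) * X (a, b) : MvPolynomial (Fin n × Fin n) NNReal)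
        ≤ complexity (C (β a) : MvPolynomial (Fin n × Fin n) NNReal) +
            complexity (X (a, b) : MvPolynomial (Fin n × Fin n) NNReal) + 1 := complexity_mul_le_holds _ _
      _ = 1 := by rw [complexity_C_holds, complexity_X_holds]
  have hsum : complexity (∑ a : Fin n, C (β a) * X (a, b) : MvPolynomial (Fin n × Fin n) NNReal) ≤ 2 * n := by
    refine (complexity_finset_sum_le _ _).trans ?_
    calc ∑ a : Fin n, complexity (C (β a) * X (a, b) : MvPolynomial (Fin n × Fin n) NNReal) + (Finset.univ : Finset (Fin n)).card
        ≤ ∑ _a : Fin n, 1 + (Finset.univ : Finset (Fin n)).card := by gcongr with a _; exact hterm a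
      _ = 2 * n := by simp; ring
  calc complexity (C γ + ∑ a : Fin n, C (β a) * X (a, b) : MvPolynomial (Fin n × Fin n) NNReal)
      ≤ complexity (C γ : MvPolynomial (Fin n × Fin n) NNReal) +
          complexity (∑ a : Fin n, C (β a) * X (a, b) : MvPolynomial (Fin n × Fin n) NNReal) + 1 :=
        complexity_add_le_holds _ _
    _ ≤ 0 + 2 * n + 1 := by rw [complexity_C_holds]; gcongr
    _ = 2 * n + 1 := by ring

/-- **Monotone complexity of a monotone column-sml expression**: `≤ s (2n² + 2n + 1)`. [folklore] -/
theorem complexity_monotoneColSml_le {n s : ℕ} (β : Fin s → Fin n → NNReal) (α : Fin s → Fin n → Fin n → NNReal) :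
    complexity (∑ t : Fin s, ∏ b : Fin n, (C (β t b) + ∑ a : Fin n, C (α t b a) * X (a, b)) :
      MvPolynomial (Fin n × Fin n) NNReal) ≤ s * (2 * n * n + 2 * n + 1) := by
  have hprod : ∀ t : Fin s, complexity (∏ b : Fin n, (C (β t b) + ∑ a : Fin n, C (α t b a) * X (a, b)) :
      MvPolynomial (Fin n × Fin n) NNReal) ≤ 2 * n * n + 2 * n := by
    intro t
    refine (complexity_finset_prod_le _ _).trans ?_
    calc ∑ b : Fin n, complexity (C (β t b) + ∑ a : Fin n, C (α t b a) * X (a, b) : MvPolynomial (Fin n × Fin n) NNReal) +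
          (Finset.univ : Finset (Fin n)).card
        ≤ ∑ _b : Fin n, (2 * n + 1) + (Finset.univ : Finset (Fin n)).card := by
          gcongr with b _; exact complexity_nnrealAffineForm_le _ _ _
      _ = 2 * n * n + 2 * n := by simp; ring
  refine (complexity_finset_sum_le _ _).trans ?_
  calc ∑ t : Fin s, complexity (∏ b : Fin n, (C (β t b) + ∑ a : Fin n, C (α t b a) * X (a, b)) :
          MvPolynomial (Fin n × Fin n) NNReal) + (Finset.univ : Finset (Fin s)).card
      ≤ ∑ _t : Fin s, (2 * n * n + 2 * n) + (Finset.univ : Finset (Fin s)).card := by gcongr with t _; exact hprod t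
    _ = s * (2 * n * n + 2 * n + 1) := by simp; ring

/-! ### The class is a sub-case of the crux, on which the crux holds -/

/-- **Monotone column-sml families satisfy the HYPOTHESIS of `MonotoneRestorationQP`** (constant `c + 4`). [folklore] -/
theorem monotoneRestorationQP_hypothesis_of_monotoneColSml (h : (n : ℕ) → MvPolynomial (Fin n × Fin n) NNReal) {c : ℕ}
    (hcirc : ∀ n : ℕ, ∃ (s : ℕ) (β : Fin s → Fin n → NNReal) (α : Fin s → Fin n → Fin n → NNReal),
      s ≤ n ^ c + c ∧ h n = ∑ t : Fin s, ∏ b : Fin n, (C (β t b) + ∑ a : Fin n, C (α t b a) * X (a, b))) :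
    ∀ n : ℕ, (h n).totalDegree ≤ (n + 2) ^ (c + 4) ∧ complexity (k := NNReal) (h n) ≤ (n + 2) ^ (c + 4) := by
  intro n
  obtain ⟨s, β, α, hs, hh⟩ := hcirc n
  have hB : 1 ≤ (n + 2) ^ (c + 3) := Nat.one_le_pow _ _ (by omega)
  refine ⟨?_, ?_⟩
  · rw [hh]
    refine (totalDegree_monotoneColSml_le β α).trans ?_
    calc n ≤ n + 2 := by omega
      _ = (n + 2) ^ 1 := (pow_one _).symm
      _ ≤ (n + 2) ^ (c + 4) := Nat.pow_le_pow_right (by omega) (by omega)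
  · rw [hh]
    refine (complexity_monotoneColSml_le β α).trans ?_
    have h1 : s ≤ 2 * (n + 2) ^ c := by
      have hp : n ^ c ≤ (n + 2) ^ c := Nat.pow_le_pow_left (by omega) c
      have hc : c ≤ (n + 2) ^ c := (Nat.lt_two_pow_self).le.trans (Nat.pow_le_pow_left (by omega) c)
      omega
    have h2 : 2 * n * n + 2 * n + 1 ≤ 2 * (n + 2) ^ 2 := by nlinarith
    have h4 : 4 ≤ (n + 2) ^ 2 := by nlinarith
    calc s * (2 * n * n + 2 * n + 1) ≤ (2 * (n + 2) ^ c) * (2 * (n + 2) ^ 2) := Nat.mul_le_mul h1 h2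
      _ = 4 * (n + 2) ^ (c + 2) := by ring
      _ ≤ (n + 2) ^ 2 * (n + 2) ^ (c + 2) := Nat.mul_le_mul_right _ h4
      _ = (n + 2) ^ (c + 4) := by ring

/-- **`MonotoneRestorationQP` HOLDS ON THE CLASS OF MATRIX-SYMMETRIC MONOTONE COLUMN-SET-MULTILINEAR `ΣΠΣ` FAMILIES**: such a
family satisfies the crux's hypothesis (degree and monotone complexity polynomially bounded) AND its conclusion (square-symmetric
circuits over `ℂ` of quasi-polynomial size computing the complexification). [folklore] -/
theorem monotoneRestorationQP_on_monotoneColSml (h : (n : ℕ) → MvPolynomial (Fin n × Fin n) NNReal)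
    (hsym : ∀ (n : ℕ) (σ τ : Equiv.Perm (Fin n)),
      MvPolynomial.rename (fun p : Fin n × Fin n => (σ p.1, τ p.2)) (h n) = h n)
    (hcirc : ∃ c : ℕ, ∀ n : ℕ, ∃ (s : ℕ) (β : Fin s → Fin n → NNReal) (α : Fin s → Fin n → Fin n → NNReal),
      s ≤ n ^ c + c ∧ h n = ∑ t : Fin s, ∏ b : Fin n, (C (β t b) + ∑ a : Fin n, C (α t b a) * X (a, b))) :
    (∃ c : ℕ, ∀ n : ℕ, (h n).totalDegree ≤ (n + 2) ^ c ∧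
      Literature.Computability.AlgebraicComplexity.complexity (k := NNReal) (h n) ≤ (n + 2) ^ c) ∧
    ∃ c : ℕ, ∀ n : ℕ, ∃ (G : Type) (_ : Fintype G) (C : LabelledArithCircuit ℂ (Fin n × Fin n) Unit G),
      C.IsSymmetric (Equiv.Perm (Fin n)) ∧
      C.eval (C.output ()) = MvPolynomial.map (Complex.ofRealHom.comp NNReal.toRealHom) (h n) ∧
      Fintype.card G ≤ 2 ^ ((Nat.log 2 n + c) ^ c) := by
  obtain ⟨c, hc⟩ := hcirc
  exact ⟨⟨c + 4, monotoneRestorationQP_hypothesis_of_monotoneColSml h hc⟩, monotoneColSml_symmetricSize h hsym ⟨c, hc⟩⟩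

end Summit.ValiantsHypothesis.ValiantsHypothesis.Theorems.SmlAffineRestoration

end
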